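import Mathlib
import Summits.ResolutionOfSingularities.ResolutionOfSingularities.Theorems.RadicialJungCleanModelsCleanProp44IsolatedTauOne
import HarnessLib

/-!
# Route `RadicialJung`, crux `CleanModels` (stmt-ResolutionOfSingularities-15917), line `Sketch` rev 35, stub 6 `stub_cleanProp44` (X44c):
# X44c in regime (I), on the stages of `stub_cleanProp44`

Seat decomp-res-hand-2 g15 (structural hand).  The stage-currency form of ✓ `exists_isCleanPermissibleSeq_lt_of_isolatedTauOne`
(`…CleanProp44IsolatedTauOne.lean`): **`cleanProp44_of_isolatedTauOne`** — the binders of `stub_cleanProp44` VERBATIM plus regime (I) «every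
`τ = 1` closed threefold point of the `μ`-stratum is isolated in `Σ` and has no very near point» ⊢ the conclusion of `stub_cleanProp44` verbatim.
This single theorem subsumes ✓ `cleanProp44_of_two_le_stalkTau` (no `τ = 1` point) and ✓ `cleanProp44_of_finite_of_forall_near_two_le` (finite
stratum), and is the sharpest unconditional case of X44c in the tree: what it leaves out is exactly «a `τ = 1` point on a curve of `Σ`» or «a `τ = 1`
point with a very near point» — the births world of memo 4e §2.4–2.6.

Honest framing: OURS; nothing here proves X44c in general, any case of `CleanModels`, or resolution of singularities in characteristic `p`.
[cite: CossartPiltant2008, Prop. 4.4] [cite: Piltant2013, Prop. 5.1 (proof, Step 2)]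
-/

noncomputable section

set_option linter.dupNamespace false -- mandated namespace of this single-conjunct summit

open CategoryTheory CategoryTheory.Limits AlgebraicGeometry TopologicalSpace IsLocalRing
open Literature.AlgebraicGeometry.Resolution Literature.AlgebraicGeometry.Motives
open Scheme.IdealSheafData
open Summit.ResolutionOfSingularities.ResolutionOfSingularities.Theorems.CP2008Prop44

namespace Summit.ResolutionOfSingularities.ResolutionOfSingularities.Theorems.RadicialJung.CleanModels

set_option maxHeartbeats 800000 in
-- long binder list
/-- **X44c (`stub_cleanProp44`) in regime (I)**: binders of `stub_cleanProp44` verbatim + «every `τ = 1` closed threefold point of the `μ`-stratum is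
isolated in `Σ` and has no very near point» ⊢ the conclusion of `stub_cleanProp44` verbatim. [cite: CossartPiltant2008, Prop. 4.4]
[cite: Piltant2013, Prop. 5.1 (proof, Step 2)] -/
theorem cleanProp44_of_isolatedTauOne :
    ∀ (p : ℕ), p.Prime → ∀ (S : Scheme.{0}) [IsIntegral S] [IsNoetherian S],
      CharP S.functionField p → Scheme.IsRegular S → Scheme.IsExcellent S → topologicalKrullDim S = 3 →
      ∀ G₀ : S.functionField, (∀ s : S, CleanRegAt p (algebraMap (S.presheaf.stalk s) S.functionField) G₀) →
      ∀ I : S.IdealSheafData, I ≠ ⊥ →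
      ∀ (X : Scheme.{0}) (ρ : X ⟶ S) [IsIntegral X] [IsNoetherian X] [IsDominant ρ],
        IsCleanRegularCentreBlowupSeq p ρ I G₀ →
        (∀ x : X, CleanRegAt p (algebraMap (X.presheaf.stalk x) X.functionField) (RatFn.functionFieldMap ρ G₀)) →
        ∀ (J : X.IdealSheafData) (μ : ℕ), 1 ≤ μ →
          (∀ x ∈ J.support, 1 < Order.coheight x) → (∀ x, idealOrder J x ≤ μ) → (∃ x, idealOrder J x = μ) →
          (∀ x : X, IsClosed ({x} : Set X) → idealOrder J x = μ → (maximalIdeal (X.presheaf.stalk x)).spanFinrank = 3 →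
            (∀ hr : IsRegularLocalRing (X.presheaf.stalk x), @stalkTau X J x hr μ = 1) →
            (∀ z : X, (μ : ℕ∞) ≤ idealOrder J z → z ⤳ x → z = x) ∧
            (∀ (hcl : IsClosed ({x} : Set X)) (X₂ : Scheme.{0}) (ϖ : X₂ ⟶ X), IsBlowup ϖ (vanishingIdeal ⟨{x}, hcl⟩) →
              ∀ w : X₂, IsClosed ({w} : Set X₂) → ϖ w = x → idealOrder (controlledTransform ϖ (vanishingIdeal ⟨{x}, hcl⟩) J μ) w = μ →
                (maximalIdeal (X₂.presheaf.stalk w)).spanFinrank = 3 →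
                ∀ hr : IsRegularLocalRing (X₂.presheaf.stalk w),
                  2 ≤ @stalkTau X₂ (controlledTransform ϖ (vanishingIdeal ⟨{x}, hcl⟩) J μ) w hr μ)) →
          ∃ (X' : Scheme.{0}) (π : X' ⟶ X) (_ : IsIntegral X') (_ : IsDominant π) (J' : X'.IdealSheafData),
            IsCleanPermissibleSeq p π J μ J' (RatFn.functionFieldMap ρ G₀) ∧ ∀ x, idealOrder J' x < μ := by
  intro p hp S _ _ hchar hS hexc hdimS G₀ _ I _ X ρ _ _ _ hρ hG J μ hμ hcodim hle _ hI
  have hρ' : IsRegularCentreBlowupSeq ρ I := hρ.isRegularCentreBlowupSeq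
  have hX : Scheme.IsRegular X := hρ'.isRegular hS
  have hqe : Scheme.IsQuasiExcellent X := hρ'.isQuasiExcellent hexc
  have hX3 : topologicalKrullDim X ≤ 3 := CP2008Prop44.topologicalKrullDim_stage_le hρ' inferInstance (n := 3) hdimS.le
  haveI hcharX : CharP X.functionField p := charP_of_injective_ringHom (RatFn.functionFieldMap ρ).injective p
  exact exists_isCleanPermissibleSeq_lt_of_isolatedTauOne hp hX hqe hX3 (RatFn.functionFieldMap ρ G₀) hG J hμ hle hcodim hI

end Summit.ResolutionOfSingularities.ResolutionOfSingularities.Theorems.RadicialJung.CleanModels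

end
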